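import Literature.Probability.Percolation.FKLoopNestingDensityLimit
import Literature.Probability.Percolation.FKLoopNestingPercolationBridge
import HarnessLib

/-!
# DKLM Corollary 10 ⇒ the `ℤ²` magic formula for critical bond percolation with density test functions

Assembly of the two companions of the named fact
`Literature.Probability.Percolation.dklm2026_corollary10` (Duminil-Copin–Kozlowski–Lammers–
Manolescu, arXiv:2603.06268, Cor. 10; `FKLoopNestingGaussianLimit`):

* `FKLoopNestingDensityLimit` — Cor. 10 specialised to test functions `φ = f dx` with `f`
  measurable, `|f| ≤ C`, `f = 0` off `B̄(0, R)`, `∫ f = 0`, for any free random-cluster limit `P`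
  (`dklm2026_corollary10.density_one` at `q = 1`);
* `FKLoopNestingPercolationBridge` — at `q = 1` the free random-cluster limit at the self-dual
  point `p = 1/2` is Mathlib's product measure `bondPercolation (zdGraph 2) half`
  (`isFreeRandomClusterLimit_bondPercolation_half`).

Together (`dklm2026_corollary10.bondPercolation_half_density`): **given the fact**, for every such
`f`,

  `E_{1/2}[∏_u 2cos(∫_{W(u,·)≠0} f + π/3)] → exp((3/4π²) ∫∫ log ‖x - y‖ f(x) f(y) dy dx)` as `δ → 0⁺`,

the expectation over Bernoulli-`1/2` bond percolation on `ℤ²` and the product over all interface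
loops `u` of `δℤ²` (both types of `bondLoopConfig δ 0`). This is, verbatim, the statement of the
crux `MagicFormulaZ2` of the route `Summits/CriticalPhenomena/CardyFormulaZ2/Theses/CardyMagicRigidity`
(item stmt-CriticalPhenomena-4834), which is therefore a one-line consequence of the named fact.
Nothing new is assumed; no definition is introduced.

## References

* H. Duminil-Copin, K. K. Kozlowski, P. Lammers, I. Manolescu, arXiv:2603.06268 (2026), §3.2,
  Cor. 10 (`q = 1`: `μ = 1/6`, `cos_μ = 2cos(· + π/3)`, `σ² = 3/π`).
* G. Grimmett, *The Random-Cluster Model* (2006), §1.2 (`q = 1` is the product measure), (6.9).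
-/

noncomputable section

open MeasureTheory Set Filter
open scoped Real Topology

namespace Literature.Probability.Percolation

open LatticeModels RandomPlanarGeometry

/-- **DKLM Cor. 10 ⇒ the `ℤ²` magic formula for critical bond percolation, density form.** Given
the named fact `dklm2026_corollary10`: for every measurable `f : ℂ → ℝ` with `|f| ≤ C`, `f = 0`
outside `B̄(0, R)` and `∫ f = 0`,
`∫ ∏_u 2cos(∫_{W(u,·)≠0} f + π/3) d(bondPercolation (zdGraph 2) half) → exp((3/4π²) ∫∫ log ‖x-y‖ f(x) f(y) dy dx)`
as the mesh `δ → 0⁺` — literally the crux `MagicFormulaZ2` of `CardyFormulaZ2/CardyMagicRigidity`.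
Assembled from `dklm2026_corollary10.density_one` and `isFreeRandomClusterLimit_bondPercolation_half`.
[cite: DuminilCopinKozlowskiLammersManolescu2026, Cor. 10 (q = 1)] -/
theorem dklm2026_corollary10.bondPercolation_half_density (h : dklm2026_corollary10)
    (f : ℂ → ℝ) (R C : ℝ) (hf : Measurable f) (hC : ∀ z, |f z| ≤ C)
    (hR : ∀ z, R < ‖z‖ → f z = 0) (h0 : ∫ z, f z = 0) :
    Tendsto
      (fun δ : ℝ ↦ ∫ cfg, (∏ᶠ u ∈ ((bondLoopConfig δ 0 cfg).F 0 ∪ (bondLoopConfig δ 0 cfg).F 1),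
        2 * Real.cos ((∫ z in {z : ℂ | u.wind z ≠ 0}, f z) + Real.pi / 3))
          ∂(bondPercolation (zdGraph 2) half))
      (nhdsWithin 0 (Set.Ioi 0))
      (nhds (Real.exp (3 / (4 * Real.pi ^ 2) * ∫ x, ∫ y, Real.log ‖x - y‖ * f x * f y))) :=
  h.density_one isFreeRandomClusterLimit_bondPercolation_half hf hC hR h0

/-- The same in the quantifier shape of the consumer crux (`∀ f R C, Measurable f → … → Tendsto …`),
so that `MagicFormulaZ2` is closed by `exact h.magicFormulaZ2_shape` given `(h : dklm2026_corollary10)`.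
[cite: DuminilCopinKozlowskiLammersManolescu2026, Cor. 10 (q = 1)] -/
theorem dklm2026_corollary10.magicFormulaZ2_shape (h : dklm2026_corollary10) :
    ∀ (f : ℂ → ℝ) (R C : ℝ), Measurable f → (∀ z, |f z| ≤ C) → (∀ z, R < ‖z‖ → f z = 0) →
      ∫ z, f z = 0 →
      Filter.Tendsto
        (fun δ : ℝ ↦ ∫ cfg, (∏ᶠ u ∈ ((bondLoopConfig δ 0 cfg).F 0 ∪ (bondLoopConfig δ 0 cfg).F 1),
          2 * Real.cos ((∫ z in {z : ℂ | u.wind z ≠ 0}, f z) + Real.pi / 3))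
            ∂(bondPercolation (zdGraph 2) half))
        (nhdsWithin 0 (Set.Ioi 0))
        (nhds (Real.exp (3 / (4 * Real.pi ^ 2) * ∫ x, ∫ y, Real.log ‖x - y‖ * f x * f y))) :=
  fun f R C hf hC hR h0 ↦ h.bondPercolation_half_density f R C hf hC hR h0

end Literature.Probability.Percolation

end
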